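import Mathlib
import HarnessLib
import Summits.ValiantsHypothesis.ValiantsHypothesis.Theses.MonotoneRestoration
import Summits.ValiantsHypothesis.ValiantsHypothesis.Theorems.MonotoneRestorationOrbitRestorationLinearVolumeQPDiNarrowSpanTight
import Summits.ValiantsHypothesis.ValiantsHypothesis.Theorems.MonotoneRestorationOrbitRestorationLinearVolumeQPNarrowSpanToDiNarrow
import Summits.ValiantsHypothesis.ValiantsHypothesis.Theorems.MonotoneRestorationOrbitCompressionQPStubOneIffDescent
import Summits.ValiantsHypothesis.ValiantsHypothesis.Theorems.MonotoneRestorationOrbitCompressionQPLift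

/-!
# Route MonotoneRestoration — aside `OrbitRestorationLinearVolumeQP` = R1 (stmt-ValiantsHypothesis-18294), line
# `birth`: qp-DESCENT SETTLES THE LINE'S RESIDUE — under S1c the registered stub `stub_lvNarrowSpan` is
# EQUIVALENT to the crux R1; and S1c is the repaired first stub of the SIBLING aside `OrbitCompressionQP`

State of line `birth` (hands 5-g2 / 6-g0 / 8-g0 / 8-g1): the registered stub `stub_lvNarrowSpan` (every `VP ∩ LV`
family lies level by level in the BIPARTITE narrow span of width `(log₂ n + c)^c`) implies R1
(`OrbitRestorationLinearVolumeQPDiNarrow.orbitRestorationLinearVolumeQP_of_lvNarrowSpanConclusion`), R1 is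
EQUIVALENT to the ONE-SORTED span statement (`…DiNarrowSpanTight`), and the converse residue was decomposed exactly as
`LvNarrowSpan ⟺ R1 ∧ LIFT_sym` (`…BlockDescentSymmetricLift`, p830544).  This file records the residue in the currency
of the sibling aside `OrbitCompressionQP` (stmt-18332), where hand `-10-g1` proved
REPAIRED STUB 1 ⟺ ABOVE-THRESHOLD qp-DESCENT ⟺ qp-LIFTING (`…StubOneIffDescent` p830538, `…Lift` p830680):

* `lvNarrowSpanConclusion_of_orbitRestorationLinearVolumeQP_of_qpDescent` — qp-DESCENT ∧ R1 ⟹ the conclusion of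
  `stub_lvNarrowSpan` for every `VP ∩ LV` family (R1 ⟹ one-sorted narrow span, p829138; `LV` families are
  matrix-symmetric; descend);
* ★ `lvNarrowSpanConclusion_iff_orbitRestorationLinearVolumeQP_of_qpDescent` — **under qp-descent (all degrees, or
  above the threshold: `…_of_qpDescentAbove`), `stub_lvNarrowSpan` ⟺ R1**: the line `birth` is TIGHT modulo S1c;
* ★ `lvNarrowSpanConclusion_iff_orbitRestorationLinearVolumeQP_of_stub1` — the same granted the REPAIRED FIRST STUB
  of line `expression_compression` of the sibling aside (stmt-18332): ONE open VH-free statement (S1c, in any of its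
  three faces) is the residue of BOTH registered lines of the two asides;
* `lvNarrowSpanConclusion_iff_orbitRestorationLinearVolumeQP_of_qpLift` — the same granted qp-LIFTING.

Honest label: conditional bridges; `stub_lvNarrowSpan` (DPS26 Outlook Q3 at qp scale, VH-strength), R1, S1c and
VP ≠ VNP are NOT proved here.  Def-free helper (`--supports stmt-ValiantsHypothesis-18294`); nothing here is a named
fact (all hypotheses verbatim).

References: Dwivedi–Pago–Seppelt 2026 (arXiv:2601.09343) Outlook Q3, Lemma 8.18; Dawar–Pago–Seppelt 2025
(arXiv:2502.06740) Thm 1.1, §7 p. 45.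
-/

noncomputable section

open scoped Classical

-- `Summit.ValiantsHypothesis.ValiantsHypothesis.…` is the tree's single-conjunct layout (Sub = Summit).
set_option linter.dupNamespace false

namespace Summit.ValiantsHypothesis.ValiantsHypothesis.Theorems

namespace LvNarrowSpanOfDescent

open Literature.Computability.AlgebraicComplexity MvPolynomial
open Literature.Combinatorics.SimpleGraph (treewidth)
open Summit.ValiantsHypothesis.ValiantsHypothesis.Theses.MonotoneRestoration (OrbitRestorationLinearVolumeQP)

/-- `LV` families (finite `ℂ`-combinations of bipartite homomorphism polynomials) are matrix-symmetric.
[folklore] -/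
theorem matrixSymmetric_of_lv (f : (n : ℕ) → MvPolynomial (Fin n × Fin n) ℂ)
    (hLV : ∃ (c : ℕ) (m : ℕ → ℕ) (a b : (n : ℕ) → Fin (m n) → ℕ)
        (E : (n : ℕ) → (i : Fin (m n)) → Multiset (Fin (a n i) × Fin (b n i)))
        (α : (n : ℕ) → Fin (m n) → ℂ),
      (∀ n, m n ≤ (n + 2) ^ c) ∧ (∀ n i, a n i + b n i ≤ c * (n + 1)) ∧
        ∀ n, f n = ∑ i : Fin (m n), C (α n i) * homPoly (E n i) n ℂ)
    (n : ℕ) (σ τ : Equiv.Perm (Fin n)) :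
    rename (fun ij : Fin n × Fin n => (σ ij.1, τ ij.2)) (f n) = f n := by
  obtain ⟨c, m, a, b, E, α, -, -, hf⟩ := hLV
  rw [hf n, map_sum]
  refine Finset.sum_congr rfl fun i _ => ?_
  rw [map_mul, rename_C, rename_perm_homPoly]

/-- **qp-DESCENT ∧ R1 ⟹ THE REGISTERED STUB'S CONCLUSION** for every `VP ∩ LV` family: R1 puts the family in
the one-sorted narrow span (`lvDiNarrowSpan_of_orbitRestorationLinearVolumeQP`, p829138), the family is
matrix-symmetric, and qp-descent (all degrees) moves it to the bipartite narrow span. [folklore] -/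
theorem lvNarrowSpanConclusion_of_orbitRestorationLinearVolumeQP_of_qpDescent
    (hdesc : ∀ c : ℕ, ∃ c' : ℕ, ∀ (n : ℕ) (p : MvPolynomial (Fin n × Fin n) ℂ),
      (∀ σ τ : Equiv.Perm (Fin n), rename (fun ij : Fin n × Fin n => (σ ij.1, τ ij.2)) p = p) →
      p ∈ Submodule.span ℂ {q : MvPolynomial (Fin n × Fin n) ℂ |
        ∃ (a : ℕ) (D : Multiset (Fin a × Fin a)),
          treewidth (SimpleGraph.fromRel fun u v : Fin a => ∃ e ∈ D, u = e.1 ∧ v = e.2) ≤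
            (Nat.log 2 n + c) ^ c ∧ q = diHomPoly D n ℂ} →
      p ∈ Submodule.span ℂ {q : MvPolynomial (Fin n × Fin n) ℂ | ∃ (a b : ℕ) (F : Multiset (Fin a × Fin b)),
        treewidth (SimpleGraph.fromRel fun u v : Fin a ⊕ Fin b =>
            ∃ e ∈ F, u = Sum.inl e.1 ∧ v = Sum.inr e.2) ≤ (Nat.log 2 n + c') ^ c' ∧ q = homPoly F n ℂ})
    (hR1 : OrbitRestorationLinearVolumeQP) :
    ∀ f : (n : ℕ) → MvPolynomial (Fin n × Fin n) ℂ, IsVPFamily f →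
      (∃ (c : ℕ) (m : ℕ → ℕ) (a b : (n : ℕ) → Fin (m n) → ℕ)
          (E : (n : ℕ) → (i : Fin (m n)) → Multiset (Fin (a n i) × Fin (b n i)))
          (α : (n : ℕ) → Fin (m n) → ℂ),
        (∀ n, m n ≤ (n + 2) ^ c) ∧ (∀ n i, a n i + b n i ≤ c * (n + 1)) ∧
          ∀ n, f n = ∑ i : Fin (m n), C (α n i) * homPoly (E n i) n ℂ) →
      ∃ c : ℕ, ∀ n : ℕ, f n ∈ Submodule.span ℂ
        {p : MvPolynomial (Fin n × Fin n) ℂ | ∃ (a b : ℕ) (E : Multiset (Fin a × Fin b)),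
          Literature.Combinatorics.SimpleGraph.treewidth
              (SimpleGraph.fromRel fun u v : Fin a ⊕ Fin b =>
                ∃ e ∈ E, u = Sum.inl e.1 ∧ v = Sum.inr e.2) ≤ (Nat.log 2 n + c) ^ c ∧
            p = homPoly E n ℂ} := by
  intro f hVP hLV
  obtain ⟨c, hc⟩ :=
    OrbitRestorationLinearVolumeQPDiNarrowSpan.lvDiNarrowSpan_of_orbitRestorationLinearVolumeQP hR1 f hVP hLV
  obtain ⟨c', hc'⟩ := hdesc c
  exact ⟨c', fun n => hc' n (f n) (matrixSymmetric_of_lv f hLV n) (hc n)⟩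

/-- ★ **UNDER qp-DESCENT (all degrees), `stub_lvNarrowSpan` ⟺ R1**: the registered line `birth` is TIGHT modulo
S1c. (`⟹`: `OrbitRestorationLinearVolumeQPDiNarrow.orbitRestorationLinearVolumeQP_of_lvNarrowSpanConclusion`,
unconditional; `⟸`: the previous theorem.) [folklore] -/
theorem lvNarrowSpanConclusion_iff_orbitRestorationLinearVolumeQP_of_qpDescent
    (hdesc : ∀ c : ℕ, ∃ c' : ℕ, ∀ (n : ℕ) (p : MvPolynomial (Fin n × Fin n) ℂ),
      (∀ σ τ : Equiv.Perm (Fin n), rename (fun ij : Fin n × Fin n => (σ ij.1, τ ij.2)) p = p) →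
      p ∈ Submodule.span ℂ {q : MvPolynomial (Fin n × Fin n) ℂ |
        ∃ (a : ℕ) (D : Multiset (Fin a × Fin a)),
          treewidth (SimpleGraph.fromRel fun u v : Fin a => ∃ e ∈ D, u = e.1 ∧ v = e.2) ≤
            (Nat.log 2 n + c) ^ c ∧ q = diHomPoly D n ℂ} →
      p ∈ Submodule.span ℂ {q : MvPolynomial (Fin n × Fin n) ℂ | ∃ (a b : ℕ) (F : Multiset (Fin a × Fin b)),
        treewidth (SimpleGraph.fromRel fun u v : Fin a ⊕ Fin b =>
            ∃ e ∈ F, u = Sum.inl e.1 ∧ v = Sum.inr e.2) ≤ (Nat.log 2 n + c') ^ c' ∧ q = homPoly F n ℂ}) :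
    (∀ f : (n : ℕ) → MvPolynomial (Fin n × Fin n) ℂ, IsVPFamily f →
      (∃ (c : ℕ) (m : ℕ → ℕ) (a b : (n : ℕ) → Fin (m n) → ℕ)
          (E : (n : ℕ) → (i : Fin (m n)) → Multiset (Fin (a n i) × Fin (b n i)))
          (α : (n : ℕ) → Fin (m n) → ℂ),
        (∀ n, m n ≤ (n + 2) ^ c) ∧ (∀ n i, a n i + b n i ≤ c * (n + 1)) ∧
          ∀ n, f n = ∑ i : Fin (m n), C (α n i) * homPoly (E n i) n ℂ) →
      ∃ c : ℕ, ∀ n : ℕ, f n ∈ Submodule.span ℂ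
        {p : MvPolynomial (Fin n × Fin n) ℂ | ∃ (a b : ℕ) (E : Multiset (Fin a × Fin b)),
          Literature.Combinatorics.SimpleGraph.treewidth
              (SimpleGraph.fromRel fun u v : Fin a ⊕ Fin b =>
                ∃ e ∈ E, u = Sum.inl e.1 ∧ v = Sum.inr e.2) ≤ (Nat.log 2 n + c) ^ c ∧
            p = homPoly E n ℂ}) ↔
    OrbitRestorationLinearVolumeQP :=
  ⟨OrbitRestorationLinearVolumeQPDiNarrow.orbitRestorationLinearVolumeQP_of_lvNarrowSpanConclusion,
    lvNarrowSpanConclusion_of_orbitRestorationLinearVolumeQP_of_qpDescent hdesc⟩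

/-- **The same under ABOVE-THRESHOLD qp-descent** (`StubOneIffDescent.qpDescentAbove_iff_qpDescent`). [folklore] -/
theorem lvNarrowSpanConclusion_iff_orbitRestorationLinearVolumeQP_of_qpDescentAbove
    (hdesc : ∀ c : ℕ, ∃ c' : ℕ, ∀ (n : ℕ) (p : MvPolynomial (Fin n × Fin n) ℂ),
      (∀ σ τ : Equiv.Perm (Fin n), rename (fun ij : Fin n × Fin n => (σ ij.1, τ ij.2)) p = p) →
      n < 2 * p.totalDegree →
      p ∈ Submodule.span ℂ {q : MvPolynomial (Fin n × Fin n) ℂ |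
        ∃ (a : ℕ) (D : Multiset (Fin a × Fin a)),
          treewidth (SimpleGraph.fromRel fun u v : Fin a => ∃ e ∈ D, u = e.1 ∧ v = e.2) ≤
            (Nat.log 2 n + c) ^ c ∧ q = diHomPoly D n ℂ} →
      p ∈ Submodule.span ℂ {q : MvPolynomial (Fin n × Fin n) ℂ | ∃ (a b : ℕ) (F : Multiset (Fin a × Fin b)),
        treewidth (SimpleGraph.fromRel fun u v : Fin a ⊕ Fin b =>
            ∃ e ∈ F, u = Sum.inl e.1 ∧ v = Sum.inr e.2) ≤ (Nat.log 2 n + c') ^ c' ∧ q = homPoly F n ℂ}) :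
    (∀ f : (n : ℕ) → MvPolynomial (Fin n × Fin n) ℂ, IsVPFamily f →
      (∃ (c : ℕ) (m : ℕ → ℕ) (a b : (n : ℕ) → Fin (m n) → ℕ)
          (E : (n : ℕ) → (i : Fin (m n)) → Multiset (Fin (a n i) × Fin (b n i)))
          (α : (n : ℕ) → Fin (m n) → ℂ),
        (∀ n, m n ≤ (n + 2) ^ c) ∧ (∀ n i, a n i + b n i ≤ c * (n + 1)) ∧
          ∀ n, f n = ∑ i : Fin (m n), C (α n i) * homPoly (E n i) n ℂ) →
      ∃ c : ℕ, ∀ n : ℕ, f n ∈ Submodule.span ℂ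
        {p : MvPolynomial (Fin n × Fin n) ℂ | ∃ (a b : ℕ) (E : Multiset (Fin a × Fin b)),
          Literature.Combinatorics.SimpleGraph.treewidth
              (SimpleGraph.fromRel fun u v : Fin a ⊕ Fin b =>
                ∃ e ∈ E, u = Sum.inl e.1 ∧ v = Sum.inr e.2) ≤ (Nat.log 2 n + c) ^ c ∧
            p = homPoly E n ℂ}) ↔
    OrbitRestorationLinearVolumeQP :=
  lvNarrowSpanConclusion_iff_orbitRestorationLinearVolumeQP_of_qpDescent
    (StubOneIffDescent.qpDescentAbove_iff_qpDescent.1 hdesc)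

/-- ★ **ONE RESIDUE FOR BOTH LINES.**  Granted the REPAIRED FIRST STUB of line `expression_compression` of the
sibling aside `OrbitCompressionQP` (stmt-18332: every matrix-symmetric family with square-symmetric circuits of
quasi-polynomial ORBIT size is, for one `c` and all `n ≥ 1`, a closed bipartite expression with
`n^{k+l} ≤ 2^{(log₂ n + c)^c}`), the registered stub `stub_lvNarrowSpan` of line `birth` of THIS aside is
EQUIVALENT to the crux R1 (`StubOneIffDescent.stub1_iff_qpDescent`). [folklore] -/
theorem lvNarrowSpanConclusion_iff_orbitRestorationLinearVolumeQP_of_stub1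
    (stub1 : ∀ f : (n : ℕ) → MvPolynomial (Fin n × Fin n) ℂ,
      (∀ (n : ℕ) (σ τ : Equiv.Perm (Fin n)),
        rename (fun ij : Fin n × Fin n => (σ ij.1, τ ij.2)) (f n) = f n) →
      (∃ c : ℕ, ∀ n : ℕ, ∃ (G : Type) (_ : Fintype G)
          (C : LabelledArithCircuit ℂ (Fin n × Fin n) Unit G),
        C.IsSymmetric (Equiv.Perm (Fin n)) ∧ C.eval (C.output ()) = f n ∧
        C.orbitSize (Equiv.Perm (Fin n)) ≤ 2 ^ ((Nat.log 2 n + c) ^ c)) →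
      ∃ c : ℕ, ∀ n : ℕ, 1 ≤ n → ∃ (k l : ℕ) (e : PatternExpr ℂ k l),
        n ^ (k + l) ≤ 2 ^ ((Nat.log 2 n + c) ^ c) ∧ e.close n = f n) :
    (∀ f : (n : ℕ) → MvPolynomial (Fin n × Fin n) ℂ, IsVPFamily f →
      (∃ (c : ℕ) (m : ℕ → ℕ) (a b : (n : ℕ) → Fin (m n) → ℕ)
          (E : (n : ℕ) → (i : Fin (m n)) → Multiset (Fin (a n i) × Fin (b n i)))
          (α : (n : ℕ) → Fin (m n) → ℂ),
        (∀ n, m n ≤ (n + 2) ^ c) ∧ (∀ n i, a n i + b n i ≤ c * (n + 1)) ∧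
          ∀ n, f n = ∑ i : Fin (m n), C (α n i) * homPoly (E n i) n ℂ) →
      ∃ c : ℕ, ∀ n : ℕ, f n ∈ Submodule.span ℂ
        {p : MvPolynomial (Fin n × Fin n) ℂ | ∃ (a b : ℕ) (E : Multiset (Fin a × Fin b)),
          Literature.Combinatorics.SimpleGraph.treewidth
              (SimpleGraph.fromRel fun u v : Fin a ⊕ Fin b =>
                ∃ e ∈ E, u = Sum.inl e.1 ∧ v = Sum.inr e.2) ≤ (Nat.log 2 n + c) ^ c ∧
            p = homPoly E n ℂ}) ↔
    OrbitRestorationLinearVolumeQP :=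
  lvNarrowSpanConclusion_iff_orbitRestorationLinearVolumeQP_of_qpDescent
    (StubOneIffDescent.stub1_iff_qpDescent.1 stub1)

/-- **The same granted qp-LIFTING** (every matrix-symmetric qp-orbit family is a block restriction of one a level
up; `OrbitCompressionLift.lift_iff_qpDescentAbove`), for any off-diagonal block substitution `φ`. [folklore] -/
theorem lvNarrowSpanConclusion_iff_orbitRestorationLinearVolumeQP_of_qpLift
    (φ : (n : ℕ) → Fin (n + n) × Fin (n + n) → MvPolynomial (Fin n × Fin n) ℂ)
    (hφ : ∀ n (i j : Fin n), φ n (finSumFinEquiv (Sum.inl i), finSumFinEquiv (Sum.inr j)) = X (i, j) ∧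
      φ n (finSumFinEquiv (Sum.inl i), finSumFinEquiv (Sum.inl j)) = 0 ∧
      φ n (finSumFinEquiv (Sum.inr i), finSumFinEquiv (Sum.inl j)) = 0 ∧
      φ n (finSumFinEquiv (Sum.inr i), finSumFinEquiv (Sum.inr j)) = 0)
    (hlift : ∀ g : (n : ℕ) → MvPolynomial (Fin n × Fin n) ℂ,
      (∀ (n : ℕ) (σ τ : Equiv.Perm (Fin n)),
        rename (fun ij : Fin n × Fin n => (σ ij.1, τ ij.2)) (g n) = g n) →
      (∃ c : ℕ, ∀ n : ℕ, ∃ (G : Type) (_ : Fintype G)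
          (C : LabelledArithCircuit ℂ (Fin n × Fin n) Unit G),
        C.IsSymmetric (Equiv.Perm (Fin n)) ∧ C.eval (C.output ()) = g n ∧
        C.orbitSize (Equiv.Perm (Fin n)) ≤ 2 ^ ((Nat.log 2 n + c) ^ c)) →
      ∃ f : (n : ℕ) → MvPolynomial (Fin n × Fin n) ℂ,
        (∀ (n : ℕ) (σ τ : Equiv.Perm (Fin n)),
          rename (fun ij : Fin n × Fin n => (σ ij.1, τ ij.2)) (f n) = f n) ∧
        (∃ c : ℕ, ∀ n : ℕ, ∃ (G : Type) (_ : Fintype G)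
            (C : LabelledArithCircuit ℂ (Fin n × Fin n) Unit G),
          C.IsSymmetric (Equiv.Perm (Fin n)) ∧ C.eval (C.output ()) = f n ∧
          C.orbitSize (Equiv.Perm (Fin n)) ≤ 2 ^ ((Nat.log 2 n + c) ^ c)) ∧
        ∀ n, aeval (φ n) (f (n + n)) = g n) :
    (∀ f : (n : ℕ) → MvPolynomial (Fin n × Fin n) ℂ, IsVPFamily f →
      (∃ (c : ℕ) (m : ℕ → ℕ) (a b : (n : ℕ) → Fin (m n) → ℕ)
          (E : (n : ℕ) → (i : Fin (m n)) → Multiset (Fin (a n i) × Fin (b n i)))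
          (α : (n : ℕ) → Fin (m n) → ℂ),
        (∀ n, m n ≤ (n + 2) ^ c) ∧ (∀ n i, a n i + b n i ≤ c * (n + 1)) ∧
          ∀ n, f n = ∑ i : Fin (m n), C (α n i) * homPoly (E n i) n ℂ) →
      ∃ c : ℕ, ∀ n : ℕ, f n ∈ Submodule.span ℂ
        {p : MvPolynomial (Fin n × Fin n) ℂ | ∃ (a b : ℕ) (E : Multiset (Fin a × Fin b)),
          Literature.Combinatorics.SimpleGraph.treewidth
              (SimpleGraph.fromRel fun u v : Fin a ⊕ Fin b =>
                ∃ e ∈ E, u = Sum.inl e.1 ∧ v = Sum.inr e.2) ≤ (Nat.log 2 n + c) ^ c ∧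
            p = homPoly E n ℂ}) ↔
    OrbitRestorationLinearVolumeQP :=
  lvNarrowSpanConclusion_iff_orbitRestorationLinearVolumeQP_of_qpDescentAbove
    ((OrbitCompressionLift.lift_iff_qpDescentAbove φ hφ).1 hlift)

end LvNarrowSpanOfDescent

end Summit.ValiantsHypothesis.ValiantsHypothesis.Theorems

end
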